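import Summits.QuantumFields.YangMills.Theorems.LangevinControlUVFemtoCurvatureTwoPointCCoreBridge
import Summits.QuantumFields.YangMills.Theorems.LangevinControlUVFemtoCurvatureTwoPointCStubExpCommutatorBracket
import Summits.QuantumFields.YangMills.Theorems.LangevinControlUVFemtoCurvatureTwoPointCStubKoszulH1
import Summits.QuantumFields.YangMills.Theorems.LangevinControlUVFemtoCurvatureTwoPointCStubHaarCoLipschitz
import Summits.QuantumFields.YangMills.Theorems.LangevinControlUVFemtoCurvatureTwoPointCStubSecondMomentOfDoubling
import Summits.QuantumFields.YangMills.Theorems.LangevinControlUVFemtoCurvatureTwoPointCStubSmallTorusOfSecondMoment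
import Summits.QuantumFields.YangMills.Theorems.LangevinControlUVFemtoCurvatureTwoPointCDoublingSublevel
import HarnessLib

/-!
# Crux `FemtoCurvatureTwoPointC` (stmt-QuantumFields-16204), line `Sketch`, v7 — the small-torus variance law is a THEOREM,
# and the crux holds modulo exactly the physics statement `AFProfilesCore`

Two closed compositions of landed files (continuation lead c5, cycle 7):

* `smallTorusVarianceLaw_holds : SmallTorusVarianceLaw` — UNCONDITIONAL. `Var_{L,β}(P) ≤ K/β²` on the six tori `2 ≤ L ≤ 7` for
  every compact `G` and every faithful unitary lattice representation, by the elementary doubling chain: commutator-vs-bracket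
  (`stub_expCommutatorBracket`) + Koszul `H¹` (`stub_koszulH1`) + Haar co-Lipschitz scaling (`stub_haarCoLipschitz`) ⇒ sublevel
  doubling `Haar{S ≤ t} ≤ K·Haar{S ≤ t/4}` (`stub_sublevelDoubling`: cone in exponential gauge slices, inverse function theorem,
  finite subcover) ⇒ `⟨S²⟩ ≤ K'/β²` (`stub_secondMomentOfDoubling`) ⇒ the law (`stub_smallTorusOfSecondMoment`). This discharges, for
  this crux, every use of the Literature named fact `WilsonPartitionRegularVariation` (cf. the conditional
  `smallTorusVarianceLaw_of_RV`): no resolution of singularities is needed for doubling.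
* `femtoCurvatureTwoPointC_of_core : AFProfilesCore → FemtoCurvatureTwoPointC` — the crux BY NAME from the single remaining
  (physics, crux-sized) statement `AFProfilesCore` (interior two-sided transverse profiles of the dimension-8 plaquette–plaquette
  covariance in the femto regime; `…CDefsCore`), via the landed v6 bridge `femtoCurvatureTwoPointC_of_core_of_small`.
No definitions; nothing else is assumed.
-/

set_option autoImplicit false

noncomputable section

open MeasureTheory
open Literature.MathematicalPhysics.QuantumLattice Literature.MathematicalPhysics.QuantumFieldTheory

namespace Summit.QuantumFields.YangMills.Theorems.FemtoCurvatureTwoPointC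

/-- **The small-torus variance law holds** (unconditionally): for every compact simple `G` and faithful unitary `r`,
`Var_{L,β}(P) ≤ K/β²` for `2 ≤ L ≤ 7`, `β ≥ β₀` — ingredient stubs ⇒ sublevel doubling ⇒ second moment ⇒ variance law.
(The simplicity hypothesis is not used.) -/
theorem smallTorusVarianceLaw_holds : Summit.QuantumFields.YangMills.Theorems.FemtoCurvatureTwoPointC.SmallTorusVarianceLaw := by
  intro G _ _ _ _ _ _ _hG r
  exact stub_smallTorusOfSecondMoment G r fun L _ =>
    stub_secondMomentOfDoubling G r L
      (stub_sublevelDoubling stub_expCommutatorBracket stub_koszulH1 stub_haarCoLipschitz G r L)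

/-- **The crux modulo the physics.** `AFProfilesCore → FemtoCurvatureTwoPointC`: the route decl of crux stmt-QuantumFields-16204
follows from the interior-profile statement alone, the small tori being supplied by `smallTorusVarianceLaw_holds`. -/
theorem femtoCurvatureTwoPointC_of_core : Summit.QuantumFields.YangMills.Theorems.FemtoCurvatureTwoPointC.AFProfilesCore → Summit.QuantumFields.YangMills.Theses.LangevinControlUV.FemtoCurvatureTwoPointC :=
  fun hcore => femtoCurvatureTwoPointC_of_core_of_small hcore smallTorusVarianceLaw_holds

end Summit.QuantumFields.YangMills.Theorems.FemtoCurvatureTwoPointC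

end
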